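import Mathlib
import HarnessLib
import HarnessLib.Audit
import Summits.HodgeConjecture.Statement
import Summits.HodgeConjecture.HodgeConjecture.Theorems.WeilTypeLadderSimilarReach
import HarnessLib.Audit.Status.Attr

/-!
Route: RealMultiplicationPencil

CLOSED (superseded) 2026-08-28T02:24:37Z by planner-hodge-idea-1-g3-0 — reason: superseded:route-HodgeConjecture-DoublyPolarisedTransport — superseded by route-HodgeConjecture-DoublyPolarisedTransport — note: I-a W-FREE but RM inessential (I-a-RMPencil.md on 24412); folded into №8c rev 3/4 (799aee18f06b retriage aside, cb79e318924b rationale) as door-B/RM aside RMAnchorLocalClause; critic PASS-WITH-PRICE variant row l.23691 + addendum 02:04:10Z; director R12.9a. The file is kept as the record of this route; refuted decls are indexed as negative knowledge (`ledger negatives`).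

# Route RealMultiplicationPencil — local algebraicity of Weil classes at simple real-multiplication
anchors, retuned across the RM pencil of split polarisations, transports Markman's floor to every
cell

It suffices (for rung H2 = `SevenfoldWeilCensus.WeilSixfolds`, item 2524 — NOT the summit; no summit
is proved by this line) to show X = X1′ ∧ X2′.
X1′ (RMAnchorLocalClause): at every REAL-MULTIPLICATION doubly-polarised anchor — a ℚ(√−d)-Weil
sixfold (P, ψ₀) carrying ρ ∈ End(P) with
ρ² = e_F (e_F > 0 a nonsquare), ρψ₀ = ψ₀ρ, one rational polarisation datum (e,a) in a NON-split cell
and another (e′,a′) that is split/hyperbolic —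
every nonzero rational (3,3) Weil class w satisfies the LOCAL CLAUSE `WeilAnchorLocalClause 3 d P h
w` (q·h³ + w stays algebraic on a
neighbourhood of P in every polarised Weil family through (P, h)). X2′ (RMSimilarAnchors): every
non-split cell of every discriminant d contains
such an anchor Weil-similar to each of its members. With Markman's hyperbolic floor and Deligne's
similitude reach (named facts, by name) door B
of the Weil-type ladder gives H2. Lens: restrict (to RM anchors) then tighten (similitude + open
reach). bears_on: LADDER-HodgeAV rung H2 (stmt-HodgeConjecture-2524, WeilSixfolds); ideator seat
hodge-idea-1 g3, LINE g3-1.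
Lean: `Summit.HodgeConjecture.HodgeConjecture.Theses.RealMultiplicationPencil.RMAnchorLocalClause ∧
Summit.HodgeConjecture.HodgeConjecture.Theses.RealMultiplicationPencil.RMSimilarAnchors`

## Assembly
Door B of the Weil-type ladder, kernel-checked in Sketch.lean/glue.lean:
`WeilTypeLadder.weilSixfolds_of_floor_of_reachSimilar_of_similarAnchorsAwayFromSplit`
takes the floor (split targets), the reach, and for every non-split target the anchor package ⟨e_A,
a_A, P, ψ₀, e, a, w, …, local clause, similitude⟩;
X2′ supplies the anchor and the similitude, X1′ the local clause at it. All four binders are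
consumed; no FlatClassSpecialises / door L is used.

CLOSES_TARGET: closes rung H2 of HodgeConjecture: Summit.HodgeConjecture.HodgeConjecture.Theses.SevenfoldWeilCensus.WeilSixfolds (D-0061; not the summit Statement) — the deciding theorem of this route concludes that registered leaf instead of the Statement decl `HodgeConjecture` (class rung: servable and labelled, never counted as concluding the summit Statement).

Rationale: WHY THIS LINE. New anchor class and new carrier. A Weil sixfold with real multiplication by F =
ℚ(√e_F) commuting with K = ℚ(√−d) has H¹ of rank 3 over the biquadratic CM field L = KF, its
K-hermitian form is the transfer of an L/F-hermitian form H_L, and its K-discriminant is δ ≡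
e_F·N_{F/ℚ}(det H_L); twisting the polarisation inside NS(P)_ℚ = F·h by a totally positive c ∈ F
multiplies δ by N_{F/ℚ}(c), so ONE variety carries a whole F-pencil of K-polarisations, dense among
which are SPLIT ones whenever −δ ∈ N(F^×)·N(K^×)ℚ^{×2} — and e_F := (−δ/2)²+1 always arranges this
(worked cell: K = ℚ(i), δ = −3 ↦ F = ℚ(√13), 3 = 4² − 13). On each split twist Markman's secant
sheaf exists (arXiv:2502.03415, arXiv:2509.23403); its Chern character lies in ℚ[ℓ_c] ⊕ W. The RM
pencil RETUNES: powers ℓ_c^k of ≥ k+1 split directions span Sym^k NS_ℚ ∋ h^k, so a perfect complex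
glued (by non-split extensions) from finitely many twisted secant sheaves can have ch ∈ ℚ[h] ⊕ W
with nonzero W-part — a class that stays Hodge on the whole non-split h-cell, removing the
Chern-persistence obstruction (g2 memo N6) that blocks cycle/subscheme carriers; Buchweitz–Flenner /
Pridham semiregularity for complexes (arXiv:math/9912245, arXiv:1208.3111; the HSemireg venture's
currency) then deforms it sideways and yields the local clause. Generic RM members are SIMPLE with
End⁰ = L (Shimura families, doi:10.2307/1970507; Moonen–Zarhin doi:10.1515/crll.1998.034), so the
census no-gos for product anchors (⊕-kernel T2(ii)) and for rigid CM points do not apply. Versus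
listed routes: №8c DoublyPolarisedTransport asks a SUBSCHEME lift (`LiftsAlongWeilFamilies`, door L)
at doubly-polarised members witnessed by products/squares; here the conclusion is the weaker,
HC-implied local clause (on-path), the anchors are the simple RM members, and the carrier is a
complex retuned across the pencil; №5 BiquadraticSecantLift widens the CM field of the Weil
structure (L ⊃ K acting with split signature), whereas here K is kept and F is real;
MarkmanPartnerTransport needs an HK partner. Imported areas: arithmetic of hermitian forms over CM
fields (Landherr/Shimura), derived deformation theory (semiregularity of perfect complexes).
CLARIFICATIONS (idea-crit-6 verdict 2026-08-28T01:33Z, PASS-WITH-PRICE): (a) at every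
doubly-polarised RM anchor P the class w is ALREADY algebraic on P by HyperbolicFloor (Weil classes
do not see the polarisation; (P,ψ₀,ℓ_c) is hyperbolic) — the ENTIRE content of X1′
RMAnchorLocalClause is PROPAGATION of algebraicity to an open neighbourhood of P in the non-split
h-cell (the variational wall shared with the HSemireg census); nobody should book «algebraic at RM
anchors» as news. (b) X1′ types RM as ρ∘ρ = e_F•𝟙, ρψ₀ = ψ₀ρ, e_F > 0 non-square and therefore
ADMITS non-simple anchors (P = Q×Q, ρ = [[0,e_F],[1,0]]); this is harmless for truth (HC ⇒ X1′ at
every anchor) but the retuning mechanism is argued for simple members with End⁰(P) = L — provers may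
specialise: X2′ RMSimilarAnchors is free to deliver simple members (Shimura PEL points with End⁰ = L
are very general on the RM locus), and if a proof of X1′ needs End-rank 4 a support item «X1′
restricted to End⁰(P) = L» + the matching X2′ output will be filed as a glued split, not a
restatement. (c) The ⊕-kernel caveat stands: cross terms Ext²(E_i,E_j) lie in the kernel of the
trace semiregularity map whether or not the Ext¹ gluing class vanishes, so instrument I-c must be
computed on the glued complex itself. (d) Definition request D1 was answered by pointer (literature
desk 01:29Z): `Literature.AlgebraicGeometry.HodgeTheory.ChernCharacterBetti` (C.ch, chVirtual for
perfect complexes, ch_mem_algebraicClasses, transportFun_ch_* in SemiregularVariationalHodge.lean,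
BuchweitzFlenner2003_variationalHodge_semiregular, Perry2026_semiregular_remainsAlgebraic) is the
sheaf-door API; the only missing piece for the twist step ch(F⊗L_c) = ch(F)·exp(c₁L_c) is tensor
multiplicativity, requested narrowly as ChernCharacterBetti.IsMultiplicative.

RANKED CRUXES. rank 2 RMAnchorLocalClause (crux); rank 3 RMSimilarAnchors (crux); rank 9
HyperbolicFloor (support); rank 9 SimilarReach (support). Rank 2 X1′ RMAnchorLocalClause is the
hard, informative step (propagation off the RM anchor; width 0 until instrument I-a returns, per
critic price 1); rank 3 X2′ RMSimilarAnchors is M-grade hermitian arithmetic (Landherr + Shimura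
PEL), recorded ALSO as a second anchor class under №8c's supply item stmt-HodgeConjecture-23603
(critic price 2); HyperbolicFloor and SimilarReach are shared named facts (support).

KILL CRITERIA. ¬X1′ at one RM anchor (a Weil family through an RM member on which q h³ + w is NOT
algebraic near it) refutes the route and, HC being what it is, much more — close
refuted:RMAnchorLocalClause. A proof that every Chern-retuned combination at RM points glues only
split (instrument I-b) or is never semiregular (I-c) kills the MECHANISM: pivot X1′ to the HSemireg
venture's pro-Artinian currency or retire. ¬X2′ for some cell (no RM member with a split twist)
restricts the route to the cells the recipe serves — pivot to a cell-indexed X2′. H2 proved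
elsewhere (№1 census, №8c, Markman for all δ) moots it.

NOT DECOMPOSED YET. The sheaf door (flat perfect complexes ⇒ local clause) is not an item: the tree
has no Chern character for coherent sheaves on SchemeOver ℂ (definition request below); the
Ext¹/semiregularity computations at a CM RM point are instrument rows, not items; the
(0,3),(3,0)-signature RM points (isolated CM members) versus the 4-dimensional (1,2),(2,1) locus are
not separated in the typed crux.

CHEAPEST FALSIFIER. Instrument row that would refute the key lemma X1′ = I-a/I-b/I-c below (I-c is
the census/HSemireg desk's Buchweitz–Flenner rank row at the CM RM member of the ℚ(i), δ = −3, F =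
ℚ(√13) cell). Instrument I-a (desk computation, ring2/hsemireg hold Markman's formulas): from ch(𝓑)
of the secant sheaf (arXiv:2502.03415 §9, arXiv:2509.23403 §11) write the linear functionals "Sym^k
F-component of Σ ε_i ch(u_i^*𝓑_{c_i} ⊗ L_i) is proportional to h^k" (k = 1,2,4,5) and "ch₃ ∈ ℚh³ ⊕
W"; if the W-coefficient functional lies in their span, every retuned combination has W-part 0 and
X1′'s mechanism is dead on arrival. Second: I-b, Ext¹ between two distinct twists at the RM CM point
E_i-type member of the ℚ(i), δ = −3 cell with F = ℚ(√13) (Mukai/Fourier side: secant sheaves are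
Fourier–Mukai images; Ext computable). I ran neither (no kit in this seat); X2′'s recipe was checked
by hand on (ℚ(i), δ = −3).

Novelty: Searches (2026-08-28): lit search --hybrid "Weil type abelian variety real multiplication Hodge
classes algebraic second polarization" (8 docs: deligne1982 pp157/47, green1994 pp218–220 [van
Geemen lectures], kerr2016 p299, carlson2017 p214 — none with an RM pencil); lit vsearch "Weil
classes … quartic CM field containing an imaginary quadratic field are algebraic" (green1994 p219,
kerr2016 p50); lit search "Moonen Zarhin Weil classes" (6: paper:arxiv-2509.23403 p4,21;
paper:arxiv-alg-geom_9612017; paper:arxiv-alg-geom_9709030 p15–16); lit galaxy search "Weil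
type|real multiplication|secant sheaf" --star pdf (8 hits, all off-topic) and
"semiregularity|hyperholomorphic|Weil classes" --star pdf (8, off-topic: no galaxy hit); tree: rg
IsWeilSimilar/IsHyperbolicWeilType/WeilAnchorLocalClause; ledger negatives HodgeConjecture (read in
survey).
Nearest prior art found: [corpus:paper:arxiv-2509.23403 p4] Markman, secant sheaves give Weil
classes on split sixfolds; [corpus:paper:arxiv-alg-geom_9612017 p2 L47, p4 L81–111] Moonen–Zarhin,
Weil classes relative to a CM field E ⊃ k and its totally real subfield E₀ (the W_L set-up);
[corpus:book:green1994 p218–220] van Geemen's lectures (Weil classes, Schoen's ℚ(i)/ℚ(ω) cases);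
in-tree №8c DoublyPolarisedTransport (doubly-polarised anchors, subscheme door).
Delta: nobody in the searched literature or the route list uses the real-multiplication pencil of
K-polarisations on ONE simple Weil sixfold to retune Markman's secant sheaves into a Ho  [refs: paper:arxiv-2509.23403, paper:arxiv-alg-geom_9612017, paper:arxiv-alg-geom_9709030, book:green1994]

Barriers (technique_class: sheaf-deformation, semiregularity, rm-anchors): - technique_class: sheaf-deformation, semiregularity, rm-anchors
- Literature.Barriers.HodgeConjecture.Andre1996_hodgeClassesOnAbelianVarieties_motivated: not used —
the line never argues motivated ⇒ algebraic; André's theorem is informational only (W is motivated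
like every Hodge class on an abelian variety; algebraicity comes from sheaves on split twists +
deformation).
- Literature.Barriers.HodgeConjecture.CattaniDeligneKaplan1995_hodgeLocus_algebraicFor: consistent,
not an obstruction — the local clause lives on open subsets of the (algebraic) Hodge locus of q·h³ +
w, which contains the whole h-cell; the line needs openness of the ALGEBRAICITY locus near RM
members, which CDK does not give and X1′ asserts.
- Literature.Barriers.HodgeConjecture.AtiyahHirzebruch1962_torsionClass_notAlgebraic: outside —
rational coefficients throughout (q : ℚ, rational classes); no integral claim.
- Literature.Barriers.HodgeConjecture.Kollar1992_nonTorsionClass_notAlgebraic: outside — same reason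
(ℚ-coefficients; Chern characters are rational).
- Literature.Barriers.HodgeConjecture.Grothendieck1969_generalHodgeConjecture_false: outside — no
coniveau / generalized-Hodge claim is made; only algebraicity of (3,3) classes.
- uncatalogued but relevant (by decl): KaehlerCounterexamples
(Zucker1977_kaehlerTorus_noAnalyticCycles) and KaehlerCoherentSheaves
(Voisin2002_weilTorus_hodgeClassWithoutSubvarieties) — outside: every deformation used stays inside
a polarised family (the h-cell), never throug

History (route lifecycle, newest last):
- 2026-08-28T02:24:38Z · CLOSED superseded — superseded:route-HodgeConjecture-DoublyPolarisedTransport (planner-hodge-idea-1-g3-0)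

sub-problem: HodgeConjecture · status: closed(superseded) · opened planner-hodge-idea-1-g3-0 2026-08-28T01:24:25Z · rev 2 · ledger route-HodgeConjecture-RealMultiplicationPencil
GENERATED by the gate from the ledger (D-0016/17). Provers cite these decls: `theorem foo : Summit.HodgeConjecture.HodgeConjecture.Theses.RealMultiplicationPencil.<Decl> := …` in Summits/HodgeConjecture/HodgeConjecture/Theorems/<Name>.lean.
-/

namespace Summit.HodgeConjecture.HodgeConjecture.Theses.RealMultiplicationPencil

open scoped BigOperators Topology Manifold Classical MeasureTheory ProbabilityTheory Matrix InnerProductSpace ComplexConjugate ContinuousMap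
open Filter Set Function TopologicalSpace MeasureTheory

attribute [summit_statement] _root_.HodgeConjecture
attribute [summit_statement] _root_.Summit.HodgeConjecture.HodgeConjecture.Theses.SevenfoldWeilCensus.WeilSixfolds

/-- item stmt-HodgeConjecture-24412 · crux · rank 2 · open · by planner
why it might fail: the retuned complex may be forced split (Ext¹ between distinct twists u_i^*𝓑_{c_i}⊗L_i zero at RM points) or non-semiregular; then only the split summands deform and ch₃'s W-part dies off the RM locus exactly as in census T2(ii).
sources: arXiv:2502.03415, arXiv:2509.23403, arXiv:math/9912245, arXiv:1208.3111, doi:10.1515/crll.1998.034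
[crux] at every real-multiplication doubly-polarised ℚ(√−d)-Weil sixfold anchor (P, ψ₀, ρ, e_F;
(e,a) non-split, (e′,a′) hyperbolic) every nonzero rational (3,3) Weil class w satisfies the local
clause WeilAnchorLocalClause 3 d P h w for h = d·a|_P + ψ₀^*(a|_P). [difficulty: open-problem] -/
@[route_item "route-HodgeConjecture-RealMultiplicationPencil", crux]
def RMAnchorLocalClause : Prop :=
  ∀ d : ℕ, 0 < d → ∀ (P : Literature.AlgebraicGeometry.Motives.AbelianVariety ℂ) (ψ₀ ρ : P ⟶ P) (eF : ℕ) (e e' : Literature.AlgebraicGeometry.Motives.ProjectiveEmbedding P.X) (a : Literature.AlgebraicGeometry.HodgeTheory.complexBetti (Literature.AlgebraicGeometry.Motives.projectiveSpace e.n ℂ) 2) (a' : Literature.AlgebraicGeometry.HodgeTheory.complexBetti (Literature.AlgebraicGeometry.Motives.projectiveSpace e'.n ℂ) 2) (w : Literature.AlgebraicGeometry.HodgeTheory.complexBetti P.X (2 * 3)), P.dim = 2 * 3 → CategoryTheory.CategoryStruct.comp ψ₀ ψ₀ = -(d • CategoryTheory.CategoryStruct.id P) → 0 < eF → ¬ IsSquare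 eF → CategoryTheory.CategoryStruct.comp ρ ρ = eF • CategoryTheory.CategoryStruct.id P → CategoryTheory.CategoryStruct.comp ρ ψ₀ = CategoryTheory.CategoryStruct.comp ψ₀ ρ → Literature.AlgebraicGeometry.HodgeTheory.IsRationalClass a → a ≠ 0 → Literature.AlgebraicGeometry.HodgeTheory.IsRationalClass a' → a' ≠ 0 → w ∈ Literature.AlgebraicGeometry.HodgeTheory.weilClassesOf P ψ₀ 3 d → Literature.AlgebraicGeometry.HodgeTheory.IsRationalClass w → w ≠ 0 → Literature.AlgebraicGeometry.HodgeTheory.IsOfHodgeType (2 * 3) P.X (2 * 3) 3 3 w → Literature.AlgebraicGeometry.Motives.IsHyperbolicWeilType P ψ₀ 3 ((d : ℂ) • Literature.AlgebraicGeometry.HodgeTheory.complexBetti.map e'.ι 2 a' + Literature.AlgebraicGeometry.HodgeTheory.complexBetti.map ψ₀.hom.hom.hom 2 (Literature.AlgebraicGeometry.HodgeTheory.complexBetti.map e'.ι 2 a')) → ¬ Literature.AlgebraicGeometry.Motives.IsHyperbolicWeilType P ψ₀ 3 ((d : ℂ) • Literature.AlgebraicGeometry.HodgeTheory.complexBetti.map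 e.ι 2 a + Literature.AlgebraicGeometry.HodgeTheory.complexBetti.map ψ₀.hom.hom.hom 2 (Literature.AlgebraicGeometry.HodgeTheory.complexBetti.map e.ι 2 a)) → Literature.AlgebraicGeometry.HodgeTheory.WeilAnchorLocalClause 3 d P ((d : ℂ) • Literature.AlgebraicGeometry.HodgeTheory.complexBetti.map e.ι 2 a + Literature.AlgebraicGeometry.HodgeTheory.complexBetti.map ψ₀.hom.hom.hom 2 (Literature.AlgebraicGeometry.HodgeTheory.complexBetti.map e.ι 2 a)) w

/-- item stmt-HodgeConjecture-24413 · crux · rank 3 · closed · moot by None · by planner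
why it might fail: the e_F = (−δ/2)²+1 recipe still needs Landherr realisation (det class D, N(D) < 0, signatures (1,2),(2,1)) and a member realising BOTH polarisation data by projective embeddings; IsWeilSimilar fixes ψ₀'s rational matrix, which may pin more than the discriminant class.
sources: doi:10.2307/1970507, doi:10.1515/crll.1998.034, paper:arxiv-alg-geom_9709030, Scharlau1985
[crux] for every d > 0 and every non-split polarised ℚ(√−d)-Weil sixfold (A, φ) carrying a nonzero
rational (3,3) Weil class there is a real-multiplication doubly-polarised anchor (P, ψ₀, ρ, e_F,
(e,a) non-split, (e′,a′) hyperbolic, w) with (P, ψ₀, h) Weil-similar to (A, φ, h_A) for some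
rational polarisation datum (e_A, a_A) of A. [difficulty: M] -/
@[route_item "route-HodgeConjecture-RealMultiplicationPencil", crux]
def RMSimilarAnchors : Prop :=
  ∀ d : ℕ, 0 < d → ∀ (A : Literature.AlgebraicGeometry.Motives.AbelianVariety ℂ) (φ : A ⟶ A), A.dim = 2 * 3 → CategoryTheory.CategoryStruct.comp φ φ = -(d • CategoryTheory.CategoryStruct.id A) → (∀ (e : Literature.AlgebraicGeometry.Motives.ProjectiveEmbedding A.X) (a : Literature.AlgebraicGeometry.HodgeTheory.complexBetti (Literature.AlgebraicGeometry.Motives.projectiveSpace e.n ℂ) 2), Literature.AlgebraicGeometry.HodgeTheory.IsRationalClass a → a ≠ 0 → ¬ Literature.AlgebraicGeometry.Motives.IsHyperbolicWeilType A φ 3 ((d : ℂ) • Literature.AlgebraicGeometry.HodgeTheory.complexBetti.map e.ι 2 a + Literature.AlgebraicGeometry.HodgeTheory.complexBetti.map φ.hom.hom.hom 2 (Literature.AlgebraicGeometry.HodgeTheory.complexBetti.map e.ι 2 a))) → (∃ wA : Literature.AlgebraicGeometry.HodgeTheory.complexBetti A.X (2 * 3), wA ∈ Literature.AlgebraicGeometry.HodgeTheory.weilClassesOf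 A φ 3 d ∧ wA ≠ 0 ∧ Literature.AlgebraicGeometry.HodgeTheory.IsOfHodgeType (2 * 3) A.X (2 * 3) 3 3 wA) → ∃ (eA : Literature.AlgebraicGeometry.Motives.ProjectiveEmbedding A.X) (aA : Literature.AlgebraicGeometry.HodgeTheory.complexBetti (Literature.AlgebraicGeometry.Motives.projectiveSpace eA.n ℂ) 2) (P : Literature.AlgebraicGeometry.Motives.AbelianVariety ℂ) (ψ₀ ρ : P ⟶ P) (eF : ℕ) (e e' : Literature.AlgebraicGeometry.Motives.ProjectiveEmbedding P.X) (a : Literature.AlgebraicGeometry.HodgeTheory.complexBetti (Literature.AlgebraicGeometry.Motives.projectiveSpace e.n ℂ) 2) (a' : Literature.AlgebraicGeometry.HodgeTheory.complexBetti (Literature.AlgebraicGeometry.Motives.projectiveSpace e'.n ℂ) 2) (w : Literature.AlgebraicGeometry.HodgeTheory.complexBetti P.X (2 * 3)), Literature.AlgebraicGeometry.HodgeTheory.IsRationalClass aA ∧ aA ≠ 0 ∧ P.dim = 2 * 3 ∧ CategoryTheory.CategoryStruct.comp ψ₀ ψ₀ = -(d • CategoryTheory.CategoryStruct.id P) ∧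 0 < eF ∧ ¬ IsSquare eF ∧ CategoryTheory.CategoryStruct.comp ρ ρ = eF • CategoryTheory.CategoryStruct.id P ∧ CategoryTheory.CategoryStruct.comp ρ ψ₀ = CategoryTheory.CategoryStruct.comp ψ₀ ρ ∧ Literature.AlgebraicGeometry.HodgeTheory.IsRationalClass a ∧ a ≠ 0 ∧ Literature.AlgebraicGeometry.HodgeTheory.IsRationalClass a' ∧ a' ≠ 0 ∧ w ∈ Literature.AlgebraicGeometry.HodgeTheory.weilClassesOf P ψ₀ 3 d ∧ Literature.AlgebraicGeometry.HodgeTheory.IsRationalClass w ∧ w ≠ 0 ∧ Literature.AlgebraicGeometry.HodgeTheory.IsOfHodgeType (2 * 3) P.X (2 * 3) 3 3 w ∧ Literature.AlgebraicGeometry.Motives.IsHyperbolicWeilType P ψ₀ 3 ((d : ℂ) • Literature.AlgebraicGeometry.HodgeTheory.complexBetti.map e'.ι 2 a' + Literature.AlgebraicGeometry.HodgeTheory.complexBetti.map ψ₀.hom.hom.hom 2 (Literature.AlgebraicGeometry.HodgeTheory.complexBetti.map e'.ι 2 a')) ∧ ¬ Literature.AlgebraicGeometry.Motives.IsHyperbolicWeilType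 P ψ₀ 3 ((d : ℂ) • Literature.AlgebraicGeometry.HodgeTheory.complexBetti.map e.ι 2 a + Literature.AlgebraicGeometry.HodgeTheory.complexBetti.map ψ₀.hom.hom.hom 2 (Literature.AlgebraicGeometry.HodgeTheory.complexBetti.map e.ι 2 a)) ∧ Literature.AlgebraicGeometry.Motives.IsWeilSimilar 3 P ψ₀ ((d : ℂ) • Literature.AlgebraicGeometry.HodgeTheory.complexBetti.map e.ι 2 a + Literature.AlgebraicGeometry.HodgeTheory.complexBetti.map ψ₀.hom.hom.hom 2 (Literature.AlgebraicGeometry.HodgeTheory.complexBetti.map e.ι 2 a)) A φ ((d : ℂ) • Literature.AlgebraicGeometry.HodgeTheory.complexBetti.map eA.ι 2 aA + Literature.AlgebraicGeometry.HodgeTheory.complexBetti.map φ.hom.hom.hom 2 (Literature.AlgebraicGeometry.HodgeTheory.complexBetti.map eA.ι 2 aA))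

/-- item stmt-HodgeConjecture-23604 · support · rank 9 · open · by planner
sources: arXiv:2502.03415
[crux] Named fact (unrefereed preprint, imported by name, never proved here): Markman's theorem —
rational (3,3) Weil classes on hyperbolic ℚ(√-d)-Weil sixfolds are algebraic. Crux-kind only because
every binder of the deciding theorem must be an item. [difficulty: open-problem] -/
@[route_item "route-HodgeConjecture-RealMultiplicationPencil", crux]
def HyperbolicFloor : Prop :=
  Literature.AlgebraicGeometry.HodgeTheory.Markman2025_weilClasses_algebraic_hyperbolicSixfold

/-- item stmt-HodgeConjecture-23605 · support · rank 9 · open · by planner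
sources: doi:10.1007/978-3-540-38955-2_3, paper:arxiv-alg-geom_9709030
[crux] Named refereed fact, imported by name: Deligne's reach by similitude — two polarised
Weil-type abelian varieties with similar rational Hermitian data lie in one connected Weil-type
family (Mumford 1969 families; Deligne 1982 proof of Thm 4.8). [difficulty: provable-now] -/
@[route_item "route-HodgeConjecture-RealMultiplicationPencil", crux]
def SimilarReach : Prop :=
  Literature.AlgebraicGeometry.HodgeTheory.weilFamilyReach_similar

/-- item stmt-HodgeConjecture-24414 · assembly · rank 1 · closed · moot by None · by planner
sources: doi:10.1007/978-3-540-38955-2_3, arXiv:2502.03415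
[assembly] RMAnchorLocalClause → RMSimilarAnchors → HyperbolicFloor → SimilarReach → WeilSixfolds
(rung H2, by name). -/
@[route_item "route-HodgeConjecture-RealMultiplicationPencil"]
def Assembly : Prop :=
  RMAnchorLocalClause → RMSimilarAnchors → HyperbolicFloor → SimilarReach → Summit.HodgeConjecture.HodgeConjecture.Theses.SevenfoldWeilCensus.WeilSixfolds

/-! D-0027 §2.1 — DECIDING THEOREM (planner-authored via `route open/edit --closes-file`; by planner-hodge-idea-1-g3-0 2026-08-28T01:24:25Z) — ARCHIVED: route closed (superseded) 2026-08-28T02:24:37Z; kept so importers keep building: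
its hypotheses are this route's items and its conclusion the registered leaf `Summit.HodgeConjecture.HodgeConjecture.Theses.SevenfoldWeilCensus.WeilSixfolds` (rung H2, D-0061) (glue_lint), and it elaborates with this file. -/

@[closes "route-HodgeConjecture-RealMultiplicationPencil"] theorem closes (h₁ : RMAnchorLocalClause) (h₂ : RMSimilarAnchors) (h₃ : HyperbolicFloor) (h₄ : SimilarReach) :
    Summit.HodgeConjecture.HodgeConjecture.Theses.SevenfoldWeilCensus.WeilSixfolds :=
  Summit.HodgeConjecture.HodgeConjecture.WeilTypeLadder.weilSixfolds_of_floor_of_reachSimilar_of_similarAnchorsAwayFromSplit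
    h₃ h₄ (fun d hd A φ hA hφ hnh hwA => by
      obtain ⟨eA, aA, P, ψ₀, ρ, eF, e, e', a, a', w, haA, haA0, hP, hψ, heF, hsq, hρρ, hρψ, ha, ha0, ha', ha'0,
        hwW, hwrat, hw0, hwH, hhyp, hnhyp, hsim⟩ := h₂ d hd A φ hA hφ hnh hwA
      exact ⟨eA, aA, P, ψ₀, e, a, w, haA, haA0, hP, hψ, ha, ha0, hwW, hwrat, hw0, hwH,
        h₁ d hd P ψ₀ ρ eF e e' a a' w hP hψ heF hsq hρρ hρψ ha ha0 ha' ha'0 hwW hwrat hw0 hwH hhyp hnhyp, hsim⟩)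

end Summit.HodgeConjecture.HodgeConjecture.Theses.RealMultiplicationPencil
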